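import Literature.Analysis.FluidPDE.SolenoidalL2Duality
import Literature.Analysis.FluidPDE.ClassicalSolutionCalculus
import Mathlib.MeasureTheory.Measure.SeparableMeasure
import Mathlib.Analysis.Distribution.AEEqOfIntegralContDiff
import Mathlib.MeasureTheory.Integral.Prod
import HarnessLib

/-!
# Solenoidal space–time duality on a slab: the closing step of the `L²`-duality uniqueness proof

Analysis/FluidPDE support file for the uniqueness theorem of Furioli–Lemarié-Rieusset–Terraneo
in `C([0,T); L³)` (`Literature.Analysis.FluidPDE.IsMildNSSolutionOn.ae_eq_of_continuousInLpOn_three`,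
`Literature.Analysis.FluidPDE.kato_unique`), more precisely for the local forward-uniqueness fact
`Literature.Analysis.FluidPDE.IsMildNSSolutionOn.ae_eq_Ico_of_ae_eq_Icc_three` of `KatoUniqueness.lean`, whose
`L²`-duality proof (Lemarié-Rieusset 2016, proof of Thm. 7.7, pp. 147–151, in the maximal
regularity form of Monniaux and Lions–Masmoudi sketched there on pp. 150–151, transported to the
tree's duality formulation: test the difference `w = u - v` of the two solutions against a
space–time field `Θ` with divergence-free slices, move the heat semigroup and one derivative onto
the backward Duhamel integral `𝒰[Θ]`, and estimate) ends with a contraction inequality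
(loc. cit., p. 151, step 5: `‖w‖ ≤ C₁₀ A(τ) ‖w‖` with `A(τ) → 0`), here in the form

  `|∫_{(τ₀,τ₁]} ∫ ⟪w, Θ⟫ dx dt| ≤ κ ‖w‖_{L²((τ₀,τ₁] × E)} ‖Θ‖_{L²((τ₀,τ₁] × E)}`,  `κ < 1`,

valid for **every** space–time test field `Θ` with divergence-free time slices supported in
time inside `(τ₀, τ₁)`. This file proves, once and for all and for a general finite-dimensional
inner product space `E`, that such an inequality forces `w = 0` a.e. on the slab
(`Literature.Analysis.FluidPDE.ae_eq_zero_of_forall_abs_integral_inner_le_mul_sqrt`), provided the slices `w t` are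
square integrable and *weakly divergence free* — which is the case for the difference of two mild
solutions (`KatoUniquenessPairing.lean`, a priori `L²` bound; weak divergence-freeness is part of
`Fluid.IsMildNSSolutionOn`).

The point is a density statement: the `L²((τ₀,τ₁] × E)`-closure of the solenoidal space–time
test fields contains every square-integrable field with weakly divergence-free slices (density
of `C_c^∞((τ₀,τ₁)) ⊗ 𝒱` in `L²(τ₀,τ₁; L²_σ)`, standard). We prove it by duality
(`Literature.Analysis.FluidPDE.integral_inner_eq_zero_of_forall_smul_divFreeTest`): if `z ∈ L²` of the slab is
orthogonal to all products `η(t) φ(x)`, `η ∈ C_c^∞((τ₀,τ₁))`, `φ ∈ 𝒱 = C^∞_{c,σ}(E)`, then for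
each `φ` the fundamental lemma of the calculus of variations in `t` (Mathlib
`IsOpen.ae_eq_zero_of_integral_contDiff_smul_eq_zero`) gives `∫⟪z(t,·), φ⟫ = 0` for a.e. `t`;
since `L²(E; E)` is second countable (Mathlib `Lp.SecondCountableTopology`), a countable
`L²`-dense subfamily of `𝒱` suffices, so for a.e. `t` the slice `z(t,·)` is orthogonal to the
solenoidal space `L²_σ(E) = closure 𝒱` (`Fluid.solenoidalL2`), which contains `w t` by the
(discharged) de Rham–Helmholtz characterisation `Fluid.mem_solenoidalL2_iff`
(`mem_solenoidalL2_iff_holds`, `SolenoidalL2Duality.lean`); hence `∫∫⟪z, w⟫ = 0` by Fubini. In the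
Hilbert space `L²((τ₀,τ₁] × E; E)` this says `w ∈ (𝒯ᗮ)ᗮ = closure 𝒯` for the subspace `𝒯` of
solenoidal space–time tests (`Submodule.orthogonal_orthogonal_eq_closure`); the inequality
extends to the closure by continuity and at `Θ = w` reads `‖w‖² ≤ κ‖w‖²`, so `w = 0`.

## Main results

* `Literature.Analysis.FluidPDE.eq_zero_of_mem_closure_of_forall_abs_inner_le`: abstract contraction in a real
  inner product space.
* `Literature.Analysis.FluidPDE.integral_inner_eq_zero_of_forall_smul_divFreeTest`: the duality form of the density
  of solenoidal space–time tests in `L²(τ₀,τ₁; L²_σ)`.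
* `Literature.Analysis.FluidPDE.ae_eq_zero_of_forall_abs_integral_inner_le_mul_sqrt` and its version with a uniform
  slice bound `Literature.Analysis.FluidPDE.ae_eq_zero_of_forall_abs_integral_inner_le_mul_sqrt_of_eLpNorm_le`:
  the closing step stated above.

## Mathlib / tree search

Mathlib (this pin) has the ingredients (`Lp.SecondCountableTopology`, `L2.inner_def`,
`IsOpen.ae_eq_zero_of_integral_contDiff_smul_eq_zero`, `integral_prod`,
`Submodule.orthogonal_orthogonal_eq_closure`) and no solenoidal spaces; the tree has `L²_σ`
(`Fluid.solenoidalL2`, `LerayProjector.lean`) with `mem_solenoidalL2_iff_holds`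
(`SolenoidalL2Duality.lean`) and product test fields on slabs `(-∞,T) × E`
(`Fluid.isSpaceTimeTestOn_smul`, `LerayHopfTimeSlice.lean`, whose heavy imports we avoid by
re-deriving the ten-line whole-space version `Fluid.isSpaceTimeTestOn_smul_top`).

## References

* P. G. Lemarié-Rieusset, *The Navier–Stokes problem in the 21st century*, CRC Press 2016,
  Thm. 7.7 (p. 147) and its proof, pp. 147–151 (PDF pp. 169–173 of doi:10.1201/b19556); the
  contraction step is p. 150, item 8 (Besov form) / p. 151, item 5 (maximal-regularity form).
  Bib key `LemarieRieusset2016`.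
* G. Furioli, P. G. Lemarié-Rieusset, E. Terraneo, *Unicité dans `L³(ℝ³)` et d'autres espaces
  fonctionnels limites pour Navier–Stokes*, Rev. Mat. Iberoam. 16 (2000), 605–667, Thm. 1.
* R. Temam, *Navier–Stokes Equations* (North-Holland 1977), Ch. I, Thm. 1.4 and Thm. 1.6
  (`H = L²_σ` is the set of weakly divergence-free `L²` fields; discharged in the tree as
  `Fluid.mem_solenoidalL2_iff_holds`). Bib key `Temam1977`.
-/

noncomputable section

open MeasureTheory TopologicalSpace Set Function Filter Topology InnerProductSpace
open scoped RealInnerProductSpace ENNReal NNReal ContDiff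

namespace Literature.Analysis.FluidPDE

/-! ### Two abstract Hilbert-space lemmas -/

section Hilbert

variable {H : Type*} [NormedAddCommGroup H] [InnerProductSpace ℝ H]

/-- **Abstract contraction.** If `|⟪W, k⟫| ≤ κ ‖W‖ ‖k‖` for all `k` in a set `S` whose closure
contains `W`, with `κ < 1`, then `W = 0`: the inequality passes to the closure by continuity and
at `k = W` gives `‖W‖² ≤ κ ‖W‖²`. [folklore] -/
theorem eq_zero_of_mem_closure_of_forall_abs_inner_le {S : Set H} {W : H} {κ : ℝ} (hκ : κ < 1)
    (hbd : ∀ k ∈ S, |⟪W, k⟫| ≤ κ * ‖W‖ * ‖k‖) (hW : W ∈ closure S) : W = 0 := by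
  have hC : IsClosed {k : H | |⟪W, k⟫| ≤ κ * ‖W‖ * ‖k‖} :=
    isClosed_le (continuous_abs.comp (continuous_const.inner continuous_id))
      (continuous_const.mul continuous_norm)
  have hWW : |⟪W, W⟫| ≤ κ * ‖W‖ * ‖W‖ := (closure_minimal hbd hC) hW
  rw [real_inner_self_eq_norm_sq, abs_of_nonneg (sq_nonneg _)] at hWW
  have hWW' : ‖W‖ ^ 2 ≤ κ * ‖W‖ ^ 2 := by
    calc ‖W‖ ^ 2 ≤ κ * ‖W‖ * ‖W‖ := hWW
      _ = κ * ‖W‖ ^ 2 := by ring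
  have h2 : ‖W‖ ^ 2 = 0 := by
    by_contra h
    have hpos : 0 < ‖W‖ ^ 2 := lt_of_le_of_ne (sq_nonneg _) (Ne.symm h)
    nlinarith
  exact norm_eq_zero.1 ((pow_eq_zero_iff two_ne_zero).1 h2)

/-- **Closure by double orthogonal.** In a real Hilbert space, if `W` is orthogonal to every
vector orthogonal to the subspace `V`, then `W` lies in the closure of `V`
(`V.topologicalClosure = Vᗮᗮ`, Mathlib `Submodule.orthogonal_orthogonal_eq_closure`). [folklore] -/
theorem mem_topologicalClosure_of_forall_mem_orthogonal [CompleteSpace H] {V : Submodule ℝ H}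
    {W : H} (h : ∀ z ∈ Vᗮ, ⟪z, W⟫ = 0) : W ∈ V.topologicalClosure := by
  rw [← Submodule.orthogonal_orthogonal_eq_closure]
  exact (Submodule.mem_orthogonal _ _).2 h

end Hilbert

variable {E : Type*} [NormedAddCommGroup E] [InnerProductSpace ℝ E] [FiniteDimensional ℝ E]
  [MeasurableSpace E] [BorelSpace E]

/-! ### Pairings of square-integrable fields -/

section Pairing

variable {α : Type*} {m0 : MeasurableSpace α} {μ : Measure α}
variable {F : Type*} [NormedAddCommGroup F] [InnerProductSpace ℝ F]

/-- The pointwise inner product of two `L²` functions is integrable (Cauchy–Schwarz pointwise and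
Hölder `L² · L² ⊆ L¹`). [folklore] -/
theorem integrable_real_inner_of_memLp_two {f g : α → F} (hf : MemLp f 2 μ) (hg : MemLp g 2 μ) :
    Integrable (fun x => ⟪f x, g x⟫) μ := by
  have h : MemLp ((fun x => ‖g x‖) * fun x => ‖f x‖) 1 μ := hf.norm.mul hg.norm
  refine (memLp_one_iff_integrable.1 h).mono' (hf.1.inner hg.1) (Eventually.of_forall fun x => ?_)
  rw [Pi.mul_apply, Real.norm_eq_abs, mul_comm]
  exact abs_real_inner_le_norm _ _

/-- The squared `L²` norm of the class of `f` is `∫ ‖f‖²`. [folklore] -/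
theorem norm_toLp_sq_eq_integral_sq_norm {f : α → F} (hf : MemLp f 2 μ) :
    ‖hf.toLp f‖ ^ 2 = ∫ x, ‖f x‖ ^ 2 ∂μ := by
  rw [← real_inner_self_eq_norm_sq, L2.inner_def]
  refine integral_congr_ae ?_
  filter_upwards [hf.coeFn_toLp] with x hx
  rw [hx, real_inner_self_eq_norm_sq]

/-- The inner product of two `L²` classes given by representatives is the integral of the
pointwise inner product of the representatives. [folklore] -/
theorem inner_eq_integral_of_coeFn_ae_eq {f g : α → F} {f' g' : Lp F 2 μ}
    (hf : (f' : α → F) =ᵐ[μ] f) (hg : (g' : α → F) =ᵐ[μ] g) :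
    ⟪f', g'⟫ = ∫ x, ⟪f x, g x⟫ ∂μ := by
  rw [L2.inner_def]
  refine integral_congr_ae ?_
  filter_upwards [hf, hg] with x hx hy
  rw [hx, hy]

end Pairing

/-! ### Square-integrable fields on a time slab `(τ₀, τ₁] × E` -/

section Slab

variable {F : Type*} [NormedAddCommGroup F] [InnerProductSpace ℝ F]

omit [InnerProductSpace ℝ F] in
/-- `L²` of the slab from uniformly bounded `L²` slices: a jointly measurable `w` on
`(τ₀, τ₁] × E` with `‖w t‖_{L²} ≤ M < ∞` for `t ∈ (τ₀, τ₁]` is square integrable on the slab,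
by Tonelli. [folklore] -/
theorem memLp_two_uncurry_of_eLpNorm_slice_le {τ₀ τ₁ : ℝ} {w : ℝ → E → F}
    (hwm : AEStronglyMeasurable (uncurry w)
      ((volume.restrict (Ioc τ₀ τ₁)).prod (volume : Measure E)))
    {M : ℝ≥0∞} (hM : M ≠ ⊤) (hw2 : ∀ t ∈ Ioc τ₀ τ₁, eLpNorm (w t) 2 (volume : Measure E) ≤ M) :
    MemLp (uncurry w) 2 ((volume.restrict (Ioc τ₀ τ₁)).prod (volume : Measure E)) := by
  set μt : Measure ℝ := volume.restrict (Ioc τ₀ τ₁) with hμt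
  refine ⟨hwm, ?_⟩
  have h2 : (2 : ℝ≥0∞) ≠ 0 := two_ne_zero
  have h2' : (2 : ℝ≥0∞) ≠ ⊤ := ENNReal.ofNat_ne_top
  rw [eLpNorm_eq_lintegral_rpow_enorm_toReal h2 h2']
  simp only [ENNReal.toReal_ofNat, one_div]
  refine ENNReal.rpow_lt_top_of_nonneg (by norm_num) (ne_of_lt ?_)
  -- Tonelli bound of the double integral
  have hslice : ∀ t ∈ Ioc τ₀ τ₁, ∫⁻ x, ‖uncurry w (t, x)‖ₑ ^ (2 : ℝ) ∂(volume : Measure E) ≤ M ^ 2 := by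
    intro t ht
    have h := hw2 t ht
    rw [eLpNorm_eq_lintegral_rpow_enorm_toReal h2 h2'] at h
    simp only [ENNReal.toReal_ofNat, one_div] at h
    have h' := ENNReal.rpow_le_rpow h (z := 2) (by norm_num)
    rw [← ENNReal.rpow_mul] at h'
    norm_num at h'
    simpa [uncurry] using h'
  calc ∫⁻ p, ‖uncurry w p‖ₑ ^ (2 : ℝ) ∂(μt.prod (volume : Measure E))
      ≤ ∫⁻ t, ∫⁻ x, ‖uncurry w (t, x)‖ₑ ^ (2 : ℝ) ∂(volume : Measure E) ∂μt :=
        lintegral_prod_le _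
    _ ≤ ∫⁻ _t, M ^ 2 ∂μt := by
        refine lintegral_mono_ae ?_
        filter_upwards [ae_restrict_mem measurableSet_Ioc] with t ht using hslice t ht
    _ = M ^ 2 * volume (Ioc τ₀ τ₁) := by
        rw [lintegral_const, Measure.restrict_apply_univ]
    _ < ⊤ := by
        refine ENNReal.mul_lt_top (ENNReal.pow_lt_top (lt_top_iff_ne_top.2 hM)) ?_
        rw [Real.volume_Ioc]
        exact ENNReal.ofReal_lt_top

/-- The norm of an `L²` class on the slab represented by `uncurry g` is
`(∫_{(τ₀,τ₁]} ∫ ‖g t x‖² dx dt)^{1/2}` (Fubini). [folklore] -/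
theorem norm_eq_sqrt_integral_integral_of_coeFn_ae_eq {τ₀ τ₁ : ℝ} {g : ℝ → E → F}
    (hg : MemLp (uncurry g) 2 ((volume.restrict (Ioc τ₀ τ₁)).prod (volume : Measure E)))
    {G : Lp F 2 ((volume.restrict (Ioc τ₀ τ₁)).prod (volume : Measure E))}
    (hG : (G : ℝ × E → F) =ᵐ[(volume.restrict (Ioc τ₀ τ₁)).prod (volume : Measure E)] uncurry g) :
    ‖G‖ = Real.sqrt (∫ t in Ioc τ₀ τ₁, ∫ x, ‖g t x‖ ^ 2) := by
  have hGe : G = hg.toLp (uncurry g) := by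
    refine Lp.ext ?_
    exact hG.trans hg.coeFn_toLp.symm
  have hsq : ‖G‖ ^ 2 = ∫ t in Ioc τ₀ τ₁, ∫ x, ‖g t x‖ ^ 2 := by
    rw [hGe, norm_toLp_sq_eq_integral_sq_norm hg,
      integral_prod _ ((memLp_two_iff_integrable_sq_norm hg.1).1 hg)]
    rfl
  rw [← hsq, Real.sqrt_sq (norm_nonneg _)]

/-- The inner product of two `L²` classes on the slab represented by `uncurry f`, `uncurry g` is
the iterated integral `∫_{(τ₀,τ₁]} ∫ ⟪f t x, g t x⟫ dx dt` (Fubini). [folklore] -/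
theorem inner_eq_integral_integral_of_coeFn_ae_eq {τ₀ τ₁ : ℝ} {f g : ℝ → E → F}
    (hf : MemLp (uncurry f) 2 ((volume.restrict (Ioc τ₀ τ₁)).prod (volume : Measure E)))
    (hg : MemLp (uncurry g) 2 ((volume.restrict (Ioc τ₀ τ₁)).prod (volume : Measure E)))
    {F' G' : Lp F 2 ((volume.restrict (Ioc τ₀ τ₁)).prod (volume : Measure E))}
    (hF : (F' : ℝ × E → F) =ᵐ[(volume.restrict (Ioc τ₀ τ₁)).prod (volume : Measure E)] uncurry f)
    (hG : (G' : ℝ × E → F) =ᵐ[(volume.restrict (Ioc τ₀ τ₁)).prod (volume : Measure E)] uncurry g) :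
    ⟪F', G'⟫ = ∫ t in Ioc τ₀ τ₁, ∫ x, ⟪f t x, g t x⟫ := by
  rw [inner_eq_integral_of_coeFn_ae_eq hF hG, integral_prod _ (integrable_real_inner_of_memLp_two hf hg)]
  rfl

end Slab

/-! ### Product test fields `η(t) φ(x)` on the whole space–time -/

section Product

omit [MeasurableSpace E] [BorelSpace E] [FiniteDimensional ℝ E] in
/-- The product `Θ(t,x) = η(t) φ(x)` of a smooth compactly supported `η : ℝ → ℝ` and a test field
`φ` on `E` is a space–time test field on all of `ℝ × E` (whole-space version of the tree's
`Fluid.isSpaceTimeTestOn_smul`). [folklore] -/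
theorem isSpaceTimeTestOn_smul_top {η : ℝ → ℝ} (hη : ContDiff ℝ ∞ η)
    (hηc : HasCompactSupport η) {φ : E → E} (hφ : FunctionSpaces.IsTestFunctionOn (⊤ : Opens E) φ) :
    IsSpaceTimeTestOn (⊤ : Opens (ℝ × E)) (fun t x => η t • φ x) where
  contDiff := (hη.comp contDiff_fst).smul (hφ.contDiff.comp contDiff_snd)
  hasCompactSupport := by
    refine HasCompactSupport.intro (hηc.prod hφ.hasCompactSupport) ?_
    rintro ⟨s, x⟩ hp
    rcases not_and_or.1 (fun h => hp (mem_prod.2 h)) with h | h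
    · simp [uncurry, image_eq_zero_of_notMem_tsupport h]
    · simp [uncurry, image_eq_zero_of_notMem_tsupport h]
  tsupport_subset := by simp

/-- A compactly supported function whose topological support lies in the open interval
`(τ₀, τ₁)` vanishes outside a compact interval `[a, b] ⊆ (τ₀, τ₁)`. [folklore] -/
theorem exists_Icc_of_tsupport_subset_Ioo {η : ℝ → ℝ} (hηc : HasCompactSupport η) {τ₀ τ₁ : ℝ}
    (hτ : τ₀ < τ₁) (hηs : tsupport η ⊆ Ioo τ₀ τ₁) :
    ∃ a b : ℝ, τ₀ < a ∧ b < τ₁ ∧ ∀ t, t ∉ Icc a b → η t = 0 := by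
  by_cases hK : (tsupport η).Nonempty
  · have hKc : IsCompact (tsupport η) := hηc
    refine ⟨sInf (tsupport η), sSup (tsupport η), (hηs (hKc.sInf_mem hK)).1,
      (hηs (hKc.sSup_mem hK)).2, fun t ht => ?_⟩
    refine image_eq_zero_of_notMem_tsupport fun hmem => ht ?_
    exact ⟨csInf_le hKc.bddBelow hmem, le_csSup hKc.bddAbove hmem⟩
  · refine ⟨(τ₀ + τ₁) / 2, (τ₀ + τ₁) / 2, by linarith, by linarith, fun t _ => ?_⟩
    refine image_eq_zero_of_notMem_tsupport fun hmem => hK ⟨t, hmem⟩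

end Product

/-! ### Density of solenoidal space–time tests, in duality form -/

section Density

/-- **Solenoidal space–time tests are dense in `L²(τ₀,τ₁; L²_σ)`, duality form** (standard;
the density step implicit in the duality/maximal-regularity proof of Lemarié-Rieusset 2016,
Thm. 7.7, pp. 150–151, when it is run in the tree's very weak formulation, where solutions are
only known through their pairings with solenoidal tests). Let `z` be square integrable on the slab
`(τ₀, τ₁] × E` and orthogonal there to every product `η(t) φ(x)` with `η ∈ C_c^∞((τ₀, τ₁))` and
`φ ∈ 𝒱` (smooth, compactly supported, divergence free). Then `z` is orthogonal to every
square-integrable `w` on the slab whose slices `w t` are (a.e. in `t`) in `L²` and weakly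
divergence free: `∫∫ ⟪z, w⟫ = 0`. Proof: for fixed `φ`, Fubini and the fundamental lemma of the
calculus of variations in `t` give `∫ ⟪z(t,·), φ⟫ = 0` for a.e. `t`; by second countability of
`L²(E; E)` a countable `L²`-dense part of `𝒱` suffices, so for a.e. `t` the slice `z(t,·)` is
orthogonal to `L²_σ = closure 𝒱`, which contains `w t` (Temam 1977, Ch. I, Thm. 1.4/1.6,
discharged as `mem_solenoidalL2_iff_holds`); integrate in `t`. [folklore] -/
theorem integral_inner_eq_zero_of_forall_smul_divFreeTest {τ₀ τ₁ : ℝ} {z : ℝ × E → E}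
    (hz : MemLp z 2 ((volume.restrict (Ioc τ₀ τ₁)).prod (volume : Measure E)))
    (hzo : ∀ η : ℝ → ℝ, ContDiff ℝ ∞ η → HasCompactSupport η → tsupport η ⊆ Ioo τ₀ τ₁ →
      ∀ φ : E → E, FunctionSpaces.IsTestFunctionOn (⊤ : Opens E) φ → VectorCalculus.IsDivFree φ →
        ∫ p, ⟪z p, η p.1 • φ p.2⟫ ∂((volume.restrict (Ioc τ₀ τ₁)).prod (volume : Measure E)) = 0)
    {w : ℝ → E → E}
    (hW : MemLp (uncurry w) 2 ((volume.restrict (Ioc τ₀ τ₁)).prod (volume : Measure E)))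
    (hw2 : ∀ᵐ t ∂(volume.restrict (Ioc τ₀ τ₁)), MemLp (w t) 2 (volume : Measure E))
    (hwdiv : ∀ᵐ t ∂(volume.restrict (Ioc τ₀ τ₁)), IsWeaklyDivFree (w t)) :
    ∫ p, ⟪z p, uncurry w p⟫ ∂((volume.restrict (Ioc τ₀ τ₁)).prod (volume : Measure E)) = 0 := by
  set μt : Measure ℝ := volume.restrict (Ioc τ₀ τ₁) with hμt
  -- Step 1: for each divergence-free test `φ`, `∫ ⟪z(t,·), φ⟫ = 0` for a.e. `t`
  have step1 : ∀ φ : E → E, FunctionSpaces.IsTestFunctionOn (⊤ : Opens E) φ → VectorCalculus.IsDivFree φ →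
      ∀ᵐ t ∂μt, ∫ x, ⟪z (t, x), φ x⟫ = 0 := by
    intro φ hφ hφd
    obtain ⟨C, hC⟩ := hφ.contDiff.continuous.bounded_above_of_compact_support hφ.hasCompactSupport
    -- `(t, x) ↦ φ x` is square integrable on the slab (finite time measure)
    have hφ2 : MemLp (fun p : ℝ × E => φ p.2) 2 (μt.prod (volume : Measure E)) := by
      have hmeas : AEStronglyMeasurable (fun p : ℝ × E => φ p.2) (μt.prod (volume : Measure E)) :=
        (hφ.contDiff.continuous.comp continuous_snd).aestronglyMeasurable
      rw [memLp_two_iff_integrable_sq_norm hmeas]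
      have h1 : Integrable (fun _ : ℝ => (1 : ℝ)) μt := by
        haveI : IsFiniteMeasure μt := by
          refine ⟨?_⟩
          rw [hμt, Measure.restrict_apply_univ, Real.volume_Ioc]
          exact ENNReal.ofReal_lt_top
        exact integrable_const _
      have h2 : Integrable (fun x : E => ‖φ x‖ ^ 2) (volume : Measure E) :=
        (memLp_two_iff_integrable_sq_norm hφ.contDiff.continuous.aestronglyMeasurable).1
          (hφ.contDiff.continuous.memLp_of_hasCompactSupport hφ.hasCompactSupport)
      simpa using h1.mul_prod h2
    have hI : Integrable (fun p : ℝ × E => ⟪z p, φ p.2⟫) (μt.prod (volume : Measure E)) :=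
      integrable_real_inner_of_memLp_two hz hφ2
    set g : ℝ → ℝ := fun t => ∫ x, ⟪z (t, x), φ x⟫ with hg_def
    have hg : Integrable g μt := hI.integral_prod_left
    have hU := (isOpen_Ioo (a := τ₀) (b := τ₁)).ae_eq_zero_of_integral_contDiff_smul_eq_zero
      (μ := μt) (hg.locallyIntegrable.locallyIntegrableOn _) ?_
    · have hmem : ∀ᵐ t ∂μt, t ∈ Ioo τ₀ τ₁ := by
        have h1 : ∀ᵐ t ∂μt, t ∈ Ioc τ₀ τ₁ := ae_restrict_mem measurableSet_Ioc
        have h2 : ∀ᵐ t ∂μt, t ≠ τ₁ := by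
          have : ∀ᵐ t ∂(volume : Measure ℝ), t ≠ τ₁ := by
            rw [ae_iff]
            simp
          exact ae_restrict_of_ae this
        filter_upwards [h1, h2] with t h1 h2 using ⟨h1.1, lt_of_le_of_ne h1.2 h2⟩
      filter_upwards [hU, hmem] with t ht hm using ht hm
    · intro η hη hηc hηs
      have hprod : (fun p : ℝ × E => ⟪z p, η p.1 • φ p.2⟫) = fun p => η p.1 * ⟪z p, φ p.2⟫ := by
        funext p
        rw [real_inner_smul_right]
      obtain ⟨Cη, hCη⟩ := hη.continuous.bounded_above_of_compact_support hηc
      have hIη : Integrable (fun p : ℝ × E => ⟪z p, η p.1 • φ p.2⟫) (μt.prod (volume : Measure E)) := by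
        rw [hprod]
        exact hI.bdd_mul ((hη.continuous.comp continuous_fst).aestronglyMeasurable)
          (Eventually.of_forall fun p => hCη p.1)
      have hgt : ∀ t, η t • g t = ∫ x, ⟪z (t, x), η t • φ x⟫ ∂(volume : Measure E) := by
        intro t
        simp only [hg_def, smul_eq_mul]
        rw [← integral_const_mul]
        refine integral_congr_ae (Eventually.of_forall fun x => ?_)
        simp only [real_inner_smul_right]
      calc ∫ t, η t • g t ∂μt = ∫ t, ∫ x, ⟪z (t, x), η t • φ x⟫ ∂(volume : Measure E) ∂μt :=
            integral_congr_ae (Eventually.of_forall hgt)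
        _ = ∫ p, ⟪z p, η p.1 • φ p.2⟫ ∂(μt.prod (volume : Measure E)) := (integral_prod _ hIη).symm
        _ = 0 := hzo η hη hηc hηs φ hφ hφd
  -- Step 2: a countable `L²`-dense subfamily of `𝒱` (second countability of `L²(E; E)`)
  haveI : Fact ((2 : ℝ≥0∞) ≠ ⊤) := ⟨ENNReal.ofNat_ne_top⟩
  obtain ⟨D, hDc, hDd⟩ := TopologicalSpace.exists_countable_dense (smoothSolenoidal E)
  -- Step 3: for a.e. `t`, the slice `z(t,·)` annihilates every member of `D`
  have step3 : ∀ᵐ t ∂μt, ∀ d ∈ D,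
      ∫ x, ⟪z (t, x), ((d : Lp E 2 (volume : Measure E)) : E → E) x⟫ = 0 := by
    rw [eventually_countable_ball hDc]
    intro d _
    obtain ⟨φ, hφ, hφd, hdφ⟩ := d.2
    filter_upwards [step1 φ hφ hφd] with t ht
    rw [← ht]
    refine integral_congr_ae ?_
    filter_upwards [hdφ] with x hx
    rw [hx]
  -- Step 4: the slices of `z` are square integrable for a.e. `t`
  have hzsl : ∀ᵐ t ∂μt, MemLp (fun x => z (t, x)) 2 (volume : Measure E) := by
    have h1 := hz.1.prodMk_left
    have h2 := ((memLp_two_iff_integrable_sq_norm hz.1).1 hz).prod_right_ae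
    filter_upwards [h1, h2] with t h1 h2
    exact (memLp_two_iff_integrable_sq_norm h1).2 h2
  -- Step 5: for a.e. `t`, `z(t,·) ⊥ L²_σ ∋ w t`
  have step5 : ∀ᵐ t ∂μt, ∫ x, ⟪z (t, x), w t x⟫ = 0 := by
    filter_upwards [step3, hzsl, hw2, hwdiv] with t h3 hzt hwt hdt
    set Z : Lp E 2 (volume : Measure E) := hzt.toLp _ with hZ_def
    set Wt : Lp E 2 (volume : Measure E) := hwt.toLp _ with hWt_def
    have hWt : Wt ∈ solenoidalL2 E :=
      (mem_solenoidalL2_iff_holds Wt).2 (hdt.congr_ae hwt.coeFn_toLp.symm)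
    have hZ : Z ∈ (solenoidalL2 E)ᗮ := by
      rw [Submodule.mem_orthogonal]
      have hclosed : IsClosed {u : Lp E 2 (volume : Measure E) | ⟪u, Z⟫ = 0} :=
        isClosed_eq (continuous_id.inner continuous_const) continuous_const
      -- on `𝒱` (as `L²` classes): density of `D` in the subtype
      have hS : ∀ s ∈ smoothSolenoidal E, ⟪s, Z⟫ = 0 := by
        intro s hs
        have hcl : IsClosed {d : smoothSolenoidal E | ⟪(d : Lp E 2 (volume : Measure E)), Z⟫ = 0} :=
          isClosed_eq (continuous_subtype_val.inner continuous_const) continuous_const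
        have hD : D ⊆ {d : smoothSolenoidal E | ⟪(d : Lp E 2 (volume : Measure E)), Z⟫ = 0} := by
          intro d hd
          show ⟪(d : Lp E 2 (volume : Measure E)), Z⟫ = 0
          rw [L2.inner_def, ← h3 d hd]
          refine integral_congr_ae ?_
          filter_upwards [hzt.coeFn_toLp] with x hx
          rw [hx, real_inner_comm]
        have hall := hcl.closure_subset_iff.2 hD
        rw [hDd.closure_eq] at hall
        exact hall (mem_univ (⟨s, hs⟩ : smoothSolenoidal E))
      have hspan : ∀ u ∈ Submodule.span ℝ (smoothSolenoidal E), ⟪u, Z⟫ = 0 := by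
        intro u hu
        induction hu using Submodule.span_induction with
        | mem u hu => exact hS u hu
        | zero => exact inner_zero_left _
        | add u₁ u₂ _ _ h₁ h₂ => rw [inner_add_left, h₁, h₂, add_zero]
        | smul c u _ h => rw [real_inner_smul_left, h, mul_zero]
      have hsub : ((Submodule.span ℝ (smoothSolenoidal E)).topologicalClosure : Set _) ⊆
          {u : Lp E 2 (volume : Measure E) | ⟪u, Z⟫ = 0} := by
        rw [Submodule.topologicalClosure_coe]
        exact closure_minimal hspan hclosed
      intro u hu
      exact hsub hu
    have h0 : ⟪Wt, Z⟫ = 0 := Submodule.inner_right_of_mem_orthogonal hWt hZ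
    rw [L2.inner_def] at h0
    rw [← h0]
    refine integral_congr_ae ?_
    filter_upwards [hzt.coeFn_toLp, hwt.coeFn_toLp] with x hz' hw'
    rw [hz', hw', real_inner_comm]
  -- Step 6: integrate in `t`
  have hI : Integrable (fun p : ℝ × E => ⟪z p, uncurry w p⟫) (μt.prod (volume : Measure E)) :=
    integrable_real_inner_of_memLp_two hz hW
  rw [integral_prod _ hI]
  have hae : ∀ᵐ t ∂μt, ∫ x, ⟪z (t, x), uncurry w (t, x)⟫ ∂(volume : Measure E) = (0 : ℝ) := by
    filter_upwards [step5] with t ht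
    simpa [uncurry] using ht
  calc ∫ t, ∫ x, ⟪z (t, x), uncurry w (t, x)⟫ ∂(volume : Measure E) ∂μt = ∫ _t, (0 : ℝ) ∂μt :=
        integral_congr_ae hae
    _ = 0 := by simp

end Density

/-! ### The closing step: contraction on the slab -/

section Closing

/-- **The closing step of the `L²`-duality uniqueness proof** (Lemarié-Rieusset 2016, proof of
Thm. 7.7, contraction step: p. 150, item 8 / p. 151, item 5, `‖w‖ ≤ C A(τ) ‖w‖` with
`C A(τ) < 1` forces `w = 0`; here by density and duality in `L²` of the slab). Let
`w : ℝ → E → E` be jointly measurable and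
square integrable on the slab `(τ₀, τ₁] × E`, with slices `w t ∈ L²` weakly divergence free
for a.e. `t ∈ (τ₀, τ₁]`. If for some `κ < 1` and **every** space–time test field `Θ` on `ℝ × E`
with divergence-free slices and time support in a compact interval `[a, b] ⊆ (τ₀, τ₁)`,

  `|∫_{(τ₀,τ₁]} ∫ ⟪w t x, Θ t x⟫ dx dt| ≤ κ (∫_{(τ₀,τ₁]} ∫ ‖w‖²)^{1/2} (∫_{(τ₀,τ₁]} ∫ ‖Θ‖²)^{1/2}`,

then `w t = 0` a.e. for a.e. `t ∈ (τ₀, τ₁]`. Proof: in the Hilbert space `L²((τ₀,τ₁] × E; E)`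
the admissible `Θ` form a subspace `𝒯`, the inequality extends to its closure by continuity,
the closure contains `w` by `integral_inner_eq_zero_of_forall_smul_divFreeTest` and
`𝒯ᗮᗮ = closure 𝒯`, and `Θ = w` gives `‖w‖² ≤ κ‖w‖²`. [cite: LemarieRieusset2016, proof of Thm. 7.7, p. 151, step 5 (contraction)] -/
theorem ae_eq_zero_of_forall_abs_integral_inner_le_mul_sqrt {τ₀ τ₁ : ℝ} {w : ℝ → E → E}
    (hW : MemLp (uncurry w) 2 ((volume.restrict (Ioc τ₀ τ₁)).prod (volume : Measure E)))
    (hw2 : ∀ᵐ t ∂(volume.restrict (Ioc τ₀ τ₁)), MemLp (w t) 2 (volume : Measure E))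
    (hwdiv : ∀ᵐ t ∂(volume.restrict (Ioc τ₀ τ₁)), IsWeaklyDivFree (w t))
    {κ : ℝ} (hκ : κ < 1)
    (hbd : ∀ (Θ : ℝ → E → E) (a b : ℝ), IsSpaceTimeTestOn (⊤ : Opens (ℝ × E)) Θ →
      (∀ t, VectorCalculus.IsDivFree (Θ t)) → τ₀ < a → b < τ₁ → (∀ t, t ∉ Icc a b → Θ t = 0) →
      |∫ t in Ioc τ₀ τ₁, ∫ x, ⟪w t x, Θ t x⟫| ≤
        κ * Real.sqrt (∫ t in Ioc τ₀ τ₁, ∫ x, ‖w t x‖ ^ 2) *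
          Real.sqrt (∫ t in Ioc τ₀ τ₁, ∫ x, ‖Θ t x‖ ^ 2)) :
    ∀ᵐ t ∂(volume.restrict (Ioc τ₀ τ₁)), w t =ᵐ[volume] 0 := by
  -- the degenerate slab
  rcases le_or_gt τ₁ τ₀ with hτ | hτ
  · have : (volume.restrict (Ioc τ₀ τ₁) : Measure ℝ) = 0 := by
      rw [Ioc_eq_empty (not_lt.2 hτ), Measure.restrict_empty]
    rw [this, ae_zero]
    exact eventually_bot
  set μt : Measure ℝ := volume.restrict (Ioc τ₀ τ₁) with hμt
  set μ : Measure (ℝ × E) := μt.prod (volume : Measure E) with hμ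
  -- the admissible space–time tests, as `L²` classes on the slab
  set A : Set (Lp E 2 μ) := {f | ∃ (Θ : ℝ → E → E) (a b : ℝ),
    IsSpaceTimeTestOn (⊤ : Opens (ℝ × E)) Θ ∧ (∀ t, VectorCalculus.IsDivFree (Θ t)) ∧ τ₀ < a ∧ b < τ₁ ∧
      (∀ t, t ∉ Icc a b → Θ t = 0) ∧ (f : ℝ × E → E) =ᵐ[μ] uncurry Θ} with hA
  set V : Submodule ℝ (Lp E 2 μ) := Submodule.span ℝ A with hV
  -- admissible tests are square integrable on the slab
  have hΘ2 : ∀ Θ : ℝ → E → E, IsSpaceTimeTestOn (⊤ : Opens (ℝ × E)) Θ → MemLp (uncurry Θ) 2 μ :=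
    fun Θ hΘ => hΘ.contDiff.continuous.memLp_of_hasCompactSupport hΘ.hasCompactSupport
  -- (i) `A` is a subspace: every element of `V` is represented by an admissible test
  have hVrep : ∀ f ∈ V, f ∈ A := by
    intro f hf
    induction hf using Submodule.span_induction with
    | mem f hf => exact hf
    | zero =>
      refine ⟨0, τ₀ + 1, τ₁ - 1, isSpaceTimeTestOn_zero _, fun t => ?_, by linarith, by linarith,
        fun t _ => rfl, ?_⟩
      · exact (mem_divFreeTest.1 (divFreeTest E).zero_mem).2
      · filter_upwards [Lp.coeFn_zero E 2 μ] with p hp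
        rw [hp]
        rfl
    | add f g _ _ ihf ihg =>
      obtain ⟨Θ₁, a₁, b₁, hΘ₁, hd₁, ha₁, hb₁, hs₁, hf₁⟩ := ihf
      obtain ⟨Θ₂, a₂, b₂, hΘ₂, hd₂, ha₂, hb₂, hs₂, hf₂⟩ := ihg
      refine ⟨fun t => Θ₁ t + Θ₂ t, min a₁ a₂, max b₁ b₂, ?_, fun t => ?_, lt_min ha₁ ha₂,
        max_lt hb₁ hb₂, fun t ht => ?_, ?_⟩
      · exact ⟨hΘ₁.contDiff.add hΘ₂.contDiff, hΘ₁.hasCompactSupport.add hΘ₂.hasCompactSupport,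
          by simp⟩
      · have h1 : Θ₁ t ∈ divFreeTest E := mem_divFreeTest.2 ⟨⟨hΘ₁.contDiff_slice t, hΘ₁.hasCompactSupport_slice t, by simp⟩, hd₁ t⟩
        have h2 : Θ₂ t ∈ divFreeTest E := mem_divFreeTest.2 ⟨⟨hΘ₂.contDiff_slice t, hΘ₂.hasCompactSupport_slice t, by simp⟩, hd₂ t⟩
        exact (mem_divFreeTest.1 ((divFreeTest E).add_mem h1 h2)).2
      · have ht₁ : t ∉ Icc a₁ b₁ := fun h => ht ⟨(min_le_left _ _).trans h.1, h.2.trans (le_max_left _ _)⟩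
        have ht₂ : t ∉ Icc a₂ b₂ := fun h => ht ⟨(min_le_right _ _).trans h.1, h.2.trans (le_max_right _ _)⟩
        funext x
        simp [hs₁ t ht₁, hs₂ t ht₂]
      · filter_upwards [Lp.coeFn_add f g, hf₁, hf₂] with p hp h1 h2
        rw [hp, Pi.add_apply, h1, h2]
        rfl
    | smul c f _ ih =>
      obtain ⟨Θ, a, b, hΘ, hd, ha, hb, hs, hf⟩ := ih
      refine ⟨fun t => c • Θ t, a, b, ?_, fun t => ?_, ha, hb, fun t ht => ?_, ?_⟩
      · exact ⟨contDiff_const.smul hΘ.contDiff, hΘ.hasCompactSupport.smul_left, by simp⟩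
      · have h1 : Θ t ∈ divFreeTest E := mem_divFreeTest.2 ⟨⟨hΘ.contDiff_slice t, hΘ.hasCompactSupport_slice t, by simp⟩, hd t⟩
        exact (mem_divFreeTest.1 ((divFreeTest E).smul_mem c h1)).2
      · funext x
        simp [hs t ht]
      · filter_upwards [Lp.coeFn_smul c f, hf] with p hp h1
        rw [hp, Pi.smul_apply, h1]
        rfl
  -- (ii) the inequality on `V`
  have hbdV : ∀ f ∈ (V : Set (Lp E 2 μ)),
      |⟪hW.toLp (uncurry w), f⟫| ≤ κ * ‖hW.toLp (uncurry w)‖ * ‖f‖ := by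
    intro f hf
    obtain ⟨Θ, a, b, hΘ, hΘd, ha, hb, hab, hfΘ⟩ := hVrep f hf
    rw [inner_eq_integral_integral_of_coeFn_ae_eq hW (hΘ2 Θ hΘ) hW.coeFn_toLp hfΘ,
      norm_eq_sqrt_integral_integral_of_coeFn_ae_eq hW hW.coeFn_toLp,
      norm_eq_sqrt_integral_integral_of_coeFn_ae_eq (hΘ2 Θ hΘ) hfΘ]
    exact hbd Θ a b hΘ hΘd ha hb hab
  -- (iii) `W` lies in the closure of `V`: duality
  have hWmem : hW.toLp (uncurry w) ∈ V.topologicalClosure := by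
    refine mem_topologicalClosure_of_forall_mem_orthogonal fun zz hzz => ?_
    have hzo : ∀ η : ℝ → ℝ, ContDiff ℝ ∞ η → HasCompactSupport η → tsupport η ⊆ Ioo τ₀ τ₁ →
        ∀ φ : E → E, FunctionSpaces.IsTestFunctionOn (⊤ : Opens E) φ → VectorCalculus.IsDivFree φ →
          ∫ p, ⟪(zz : ℝ × E → E) p, η p.1 • φ p.2⟫ ∂μ = 0 := by
      intro η hη hηc hηs φ hφ hφd
      obtain ⟨a, b, ha, hb, hab⟩ := exists_Icc_of_tsupport_subset_Ioo hηc hτ hηs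
      have hΘ : IsSpaceTimeTestOn (⊤ : Opens (ℝ × E)) (fun t x => η t • φ x) :=
        isSpaceTimeTestOn_smul_top hη hηc hφ
      have hΘm := hΘ2 _ hΘ
      have hmemA : hΘm.toLp _ ∈ A := by
        refine ⟨fun t x => η t • φ x, a, b, hΘ, fun t => ?_, ha, hb, fun t ht => ?_, hΘm.coeFn_toLp⟩
        · have h1 : (η t) • φ ∈ divFreeTest E :=
            (divFreeTest E).smul_mem (η t) (mem_divFreeTest.2 ⟨hφ, hφd⟩)
          exact (mem_divFreeTest.1 h1).2
        · funext x
          simp [hab t ht]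
      have horth : ⟪hΘm.toLp _, zz⟫ = 0 :=
        (Submodule.mem_orthogonal V zz).1 hzz _ (Submodule.subset_span hmemA)
      rw [L2.inner_def] at horth
      rw [← horth]
      refine integral_congr_ae ?_
      filter_upwards [hΘm.coeFn_toLp] with p hp
      rw [hp, real_inner_comm]
      rfl
    have h0 := integral_inner_eq_zero_of_forall_smul_divFreeTest (Lp.memLp zz) hzo hW hw2 hwdiv
    rw [L2.inner_def, ← h0]
    refine integral_congr_ae ?_
    filter_upwards [hW.coeFn_toLp] with p hp
    rw [hp]
  -- (iv) contraction
  have hW0 : hW.toLp (uncurry w) = 0 := by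
    refine eq_zero_of_mem_closure_of_forall_abs_inner_le hκ hbdV ?_
    rwa [← Submodule.topologicalClosure_coe]
  have hae : uncurry w =ᵐ[μ] 0 := by
    have h1 := hW.coeFn_toLp
    rw [hW0] at h1
    exact (h1.symm.trans (Lp.coeFn_zero E 2 μ))
  have h2 := Measure.ae_ae_of_ae_prod hae
  filter_upwards [h2] with t ht
  filter_upwards [ht] with x hx
  simpa [uncurry] using hx

/-- **The closing step, with a uniform slice bound** (the form produced by the a priori `L²`
bound of `KatoUniquenessPairing.lean`): as
`ae_eq_zero_of_forall_abs_integral_inner_le_mul_sqrt`, for `w` jointly measurable on the slab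
with `w t ∈ L²`, `‖w t‖_{L²} ≤ M < ∞` and `w t` weakly divergence free for every
`t ∈ (τ₀, τ₁]`. [cite: LemarieRieusset2016, proof of Thm. 7.7, p. 151, step 5 (contraction)] -/
theorem ae_eq_zero_of_forall_abs_integral_inner_le_mul_sqrt_of_eLpNorm_le {τ₀ τ₁ : ℝ}
    {w : ℝ → E → E}
    (hwm : AEStronglyMeasurable (uncurry w)
      ((volume.restrict (Ioc τ₀ τ₁)).prod (volume : Measure E)))
    {M : ℝ≥0∞} (hM : M ≠ ⊤)
    (hw2 : ∀ t ∈ Ioc τ₀ τ₁, MemLp (w t) 2 (volume : Measure E) ∧ eLpNorm (w t) 2 volume ≤ M)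
    (hwdiv : ∀ t ∈ Ioc τ₀ τ₁, IsWeaklyDivFree (w t)) {κ : ℝ} (hκ : κ < 1)
    (hbd : ∀ (Θ : ℝ → E → E) (a b : ℝ), IsSpaceTimeTestOn (⊤ : Opens (ℝ × E)) Θ →
      (∀ t, VectorCalculus.IsDivFree (Θ t)) → τ₀ < a → b < τ₁ → (∀ t, t ∉ Icc a b → Θ t = 0) →
      |∫ t in Ioc τ₀ τ₁, ∫ x, ⟪w t x, Θ t x⟫| ≤
        κ * Real.sqrt (∫ t in Ioc τ₀ τ₁, ∫ x, ‖w t x‖ ^ 2) *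
          Real.sqrt (∫ t in Ioc τ₀ τ₁, ∫ x, ‖Θ t x‖ ^ 2)) :
    ∀ᵐ t ∂(volume.restrict (Ioc τ₀ τ₁)), w t =ᵐ[volume] 0 := by
  have hW : MemLp (uncurry w) 2 ((volume.restrict (Ioc τ₀ τ₁)).prod (volume : Measure E)) :=
    memLp_two_uncurry_of_eLpNorm_slice_le hwm hM fun t ht => (hw2 t ht).2
  have h1 : ∀ᵐ t ∂(volume.restrict (Ioc τ₀ τ₁)), MemLp (w t) 2 (volume : Measure E) := by
    filter_upwards [ae_restrict_mem measurableSet_Ioc] with t ht using (hw2 t ht).1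
  have h2 : ∀ᵐ t ∂(volume.restrict (Ioc τ₀ τ₁)), IsWeaklyDivFree (w t) := by
    filter_upwards [ae_restrict_mem measurableSet_Ioc] with t ht using hwdiv t ht
  exact ae_eq_zero_of_forall_abs_integral_inner_le_mul_sqrt hW h1 h2 hκ hbd

end Closing

end Literature.Analysis.FluidPDE
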